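import Summits.BirchSwinnertonDyer.BirchSwinnertonDyer.Theorems.TangentConeEdgeDecayStubTwoVarRateOfOrder
import HarnessLib

/-!
# BirchSwinnertonDyer / TangentCone — crux `EdgeDecay` (stmt-BirchSwinnertonDyer-17608), line `lambda-layer-one`:
# lower bound along a lattice curve from a non-zero axis coefficient

Lead `prover-line-stmt-BirchSwinnertonDyer-17608-c1-0` (continuation), skeleton
`Cruxes/EdgeDecay/Lines/lambda_layer_one.lean` (v11). Elementary `p`-adic analysis, the LOWER-BOUND form of the
landed rate lemma `stub_twoVarRateOfOrder` (which ties a second value `F(x,y)` to `F(x,y_s)` by a ratio identity —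
the form the misstated ratio fact wanted): if `F = Σ F_ij Xⁱ Yʲ` has coefficients bounded by `M` in `ℚ_p` and a
non-zero coefficient `F_{0,j₀}`, `j₀ ≤ n`, on the axis `X = 0`, then for a lattice slope `a/b < 1/2` off the zeros
of the lowest form and all `t > 0` with `v_p(t) ≥ m₀`,
`1 ≤ ‖F(γ^{tb} - 1, γ^{ta} - 1)‖ · p^{n (v_p(t)+1) + C}` (`γ = 1 + p`). It is what the ratio-free bridge
`TangentConeEdgeDecayOfCycOrderAllBranches.lean` consumes: the value of the trivial-branch two-variable series at
`(x_k, y_s)` is bounded BELOW at rate `n`, and the denominators `Λ(g_k, j)` are controlled separately by integrality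
of the other Teichmüller branches.
-/

-- `Summit.BirchSwinnertonDyer.BirchSwinnertonDyer.…`: the summit and its single sub-problem share a name (D-0017 layout).
set_option linter.dupNamespace false

namespace Summit.BirchSwinnertonDyer.BirchSwinnertonDyer.Theorems

open scoped Classical
open Filter Topology

/-- **Lower bound along a lattice curve from a non-zero axis coefficient** (elementary `p`-adic analysis; the
lower-bound form of the landed rate lemma `stub_twoVarRateOfOrder`): if `F = Σ F_ij Xⁱ Yʲ` has coefficients
bounded by `M` in `ℚ_p` and `F_{0,j₀} ≠ 0` for some `j₀ ≤ n`, then there are a lattice slope `a/b < 1/2` and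
constants `m₀, C` such that for every `t > 0` with `v_p(t) ≥ m₀`,
`1 ≤ ‖F(γ^{tb} - 1, γ^{ta} - 1)‖ · p^{n (v_p(t)+1) + C}` (`γ = 1 + p`). Proof: total order `d ≤ n`;
`stub_lowestFormNonvanishing` (slope off the zeros of the lowest form), `stub_twoVarDominant` (dominant term for
`‖z‖ ≤ p^{-m₀-1}`), `stub_normCycPow` (`‖γ^t - 1‖ = p^{-1-v_p(t)}`). [folklore] -/
theorem stub_twoVarLowerBound :
    ∀ (p : ℕ) [Fact p.Prime], p ≠ 2 → ∀ (F : ℕ → ℕ → ℚ_[p]) (M : ℝ) (n : ℕ), (∀ i j : ℕ, ‖F i j‖ ≤ M) →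
      (∃ j : ℕ, j ≤ n ∧ F 0 j ≠ 0) → ∃ a b : ℕ, 0 < b ∧ 2 * a < b ∧ ∃ m₀ C : ℕ, ∀ t : ℕ, 0 < t →
        m₀ ≤ padicValNat p t →
          1 ≤ ‖∑' q : ℕ × ℕ, F q.1 q.2 * (((1 + p : ℕ) : ℚ_[p]) ^ (t * b) - 1) ^ q.1 *
                (((1 + p : ℕ) : ℚ_[p]) ^ (t * a) - 1) ^ q.2‖ * (p : ℝ) ^ (n * (padicValNat p t + 1) + C) := by
  intro p _ hp2 F M n hFM hj
  classical
  have hp : p.Prime := Fact.out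
  have hp1 : (1 : ℝ) < p := by exact_mod_cast hp.one_lt
  set γ : ℚ_[p] := ((1 + p : ℕ) : ℚ_[p]) with hγ
  obtain ⟨j₀, hj₀n, hF0j⟩ := hj
  -- the total order `d ≤ n` of `F`
  have hex : ∃ e : ℕ, ∃ i j : ℕ, i + j = e ∧ F i j ≠ 0 := ⟨j₀, 0, j₀, by simp, hF0j⟩
  obtain ⟨i₁, j₁, hij₁, hF₁⟩ : ∃ i j : ℕ, i + j = Nat.find hex ∧ F i j ≠ 0 := Nat.find_spec hex
  set d : ℕ := Nat.find hex with hd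
  have hdn : d ≤ n := (Nat.find_min' hex ⟨0, j₀, by simp, hF0j⟩).trans hj₀n
  have hlow : ∀ i j : ℕ, i + j < d → F i j = 0 := by
    intro i j hij
    by_contra hne
    exact Nat.find_min hex hij ⟨i, j, rfl, hne⟩
  -- a lattice slope `a/b < 1/2` off the zeros of the lowest form
  obtain ⟨a, b, hb, hab, hFd⟩ := stub_lowestFormNonvanishing p (fun j => F (d - j) j) d
    ⟨j₁, by omega, by show F (d - j₁) j₁ ≠ 0; rw [show d - j₁ = i₁ by omega]; exact hF₁⟩
  -- dominant term
  obtain ⟨m₀, hdom⟩ := stub_twoVarDominant p F M d a b hFM hlow hFd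
  set c₀ : ℝ := ‖∑ j ∈ Finset.range (d + 1), F (d - j) j * (b : ℚ_[p]) ^ (d - j) * (a : ℚ_[p]) ^ j‖
    with hc₀
  have hc₀pos : 0 < c₀ := norm_pos_iff.mpr hFd
  obtain ⟨C₁, hC₁⟩ : ∃ C₁ : ℕ, 1 / c₀ ≤ (p : ℝ) ^ C₁ := by
    obtain ⟨C₁, hC₁⟩ := pow_unbounded_of_one_lt (1 / c₀) hp1
    exact ⟨C₁, hC₁.le⟩
  refine ⟨a, b, hb, hab, m₀, C₁, fun t htpos hvt => ?_⟩
  -- the parameter `z = γ^t - 1`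
  set v : ℕ := padicValNat p t with hv
  set z : ℚ_[p] := γ ^ t - 1 with hz
  have hxz : (1 + z) ^ b - 1 = γ ^ (t * b) - 1 := by
    rw [hz, add_sub_cancel, ← pow_mul]
  have hyz : (1 + z) ^ a - 1 = γ ^ (t * a) - 1 := by
    rw [hz, add_sub_cancel, ← pow_mul]
  have hnz : ‖z‖ = ((p : ℝ) ^ (v + 1))⁻¹ := by
    rw [hz, hγ, stub_normCycPow p hp2 t htpos, ← hv, ← zpow_natCast, ← zpow_neg]
    congr 1
    push_cast
    ring
  have hz0 : z ≠ 0 := by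
    rw [← norm_pos_iff, hnz]; positivity
  have hzle : ‖z‖ ≤ (p : ℝ) ^ (-(m₀ : ℤ) - 1) := by
    rw [hnz, ← zpow_natCast, ← zpow_neg]
    apply zpow_le_zpow_right₀ hp1.le
    push_cast
    omega
  have hz1 : ‖z‖ ≤ 1 := by
    rw [hnz]; exact inv_le_one_of_one_le₀ (one_le_pow₀ hp1.le)
  have hdz := hdom z hz0 hzle
  rw [hxz, hyz] at hdz
  -- bookkeeping in `ℝ`
  have hzn : ‖z‖ ^ n * (p : ℝ) ^ (n * (v + 1)) = 1 := by
    rw [hnz, inv_pow, ← pow_mul, mul_comm (v + 1) n, inv_mul_cancel₀]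
    positivity
  have hzdn : ‖z‖ ^ n ≤ ‖z‖ ^ d := pow_le_pow_of_le_one (norm_nonneg _) hz1 hdn
  set V : ℝ := ‖∑' q : ℕ × ℕ, F q.1 q.2 * (γ ^ (t * b) - 1) ^ q.1 * (γ ^ (t * a) - 1) ^ q.2‖ with hV
  have hV0 : 0 ≤ V := norm_nonneg _
  have h1 : c₀ * ‖z‖ ^ n ≤ V := by
    calc c₀ * ‖z‖ ^ n ≤ c₀ * ‖z‖ ^ d := mul_le_mul_of_nonneg_left hzdn hc₀pos.le
      _ = V := hdz.symm
  have h2 : c₀ ≤ V * (p : ℝ) ^ (n * (v + 1)) := by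
    calc c₀ = c₀ * ‖z‖ ^ n * (p : ℝ) ^ (n * (v + 1)) := by rw [mul_assoc, hzn, mul_one]
      _ ≤ V * (p : ℝ) ^ (n * (v + 1)) := mul_le_mul_of_nonneg_right h1 (by positivity)
  rw [pow_add]
  have h5 : 1 ≤ V * (p : ℝ) ^ (n * (v + 1)) * (1 / c₀) := by
    rw [show V * (p : ℝ) ^ (n * (v + 1)) * (1 / c₀) = (V * (p : ℝ) ^ (n * (v + 1))) / c₀ by ring]
    rw [le_div_iff₀ hc₀pos, one_mul]
    exact h2
  calc (1 : ℝ) ≤ V * (p : ℝ) ^ (n * (v + 1)) * (1 / c₀) := h5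
    _ ≤ V * (p : ℝ) ^ (n * (v + 1)) * (p : ℝ) ^ C₁ := mul_le_mul_of_nonneg_left hC₁ (by positivity)
    _ = V * ((p : ℝ) ^ (n * (v + 1)) * (p : ℝ) ^ C₁) := by ring

end Summit.BirchSwinnertonDyer.BirchSwinnertonDyer.Theorems
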